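import Literature.Computability.QuantumComplexity.GaussianCells
import Literature.Computability.QuantumComplexity.QStateL2
import HarnessLib

/-!
# Gaussian cell weights, III: the cell qsample against the point-Gaussian state

Topic `Literature/Computability/QuantumComplexity`, sequel of `GaussianCells.lean`. The tree prepares
Regev's one-dimensional Gaussian state (Regev 2009, Lemma 3.12, eq. (10):
`Σ_{x} e^{-π(x/(√2 r))²}|x⟩`, a vector whose SQUARED amplitudes are `e^{-π x²/r²} = e^{-c x²}`) as the
Grover–Rudolph qsample of the cell weights `w(y) = ∫_u^{u+1} e^{-ct²} dt` (`u = cellPt y`), i.e. with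
amplitudes `√(w(y)/W)`. This file bounds the distance between the two normalised states:

* `GaussianCells.ptAmp c u = e^{-cu²/2}` (the point amplitude, `ptAmp_sq`), the elementary sandwich
  `e^{-cu²} e^{-c(2|u|+1)} ≤ ∫_u^{u+1} e^{-ct²}dt ≤ e^{-cu²} e^{c(2|u|+1)}` (`le_cellIntegral`,
  `cellIntegral_le`: on the cell `t² = u² ± (2|u|+1)`), hence
  **`abs_sqrt_cellIntegral_sub_ptAmp_le`**: `|√(∫_u^{u+1} e^{-ct²}) − e^{-cu²/2}| ≤ c(2|u|+1)·e^{-cu²/2}`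
  whenever `c(2|u|+1) ≤ 2` (`e^{±η/2} = 1 + O(η)`, `Real.abs_exp_sub_one_le`);
* the amplitude vectors on labels `cellAmpVec ℓ c y = √(w y)`, `ptAmpVec ℓ c y = e^{-c·(cellPt y)²/2}`
  (as complex vectors), `|cellPt y| ≤ 2^ℓ`, and **`l2_normalize_ptAmpVec_sub_normalize_cellAmpVec_le`**:
  `‖p̂t − ĉell‖₂ ≤ 2η`, `η = c(2·2^ℓ + 1) ≤ 2` (termwise relative closeness, then
  `QState.l2_normalize_sub_normalize_le`);
* on a register: `GroverRudolph.qsample (cellW ℓ c) ws x = Σ_y ĉell(y) |x[ws ↦ y]⟩` (`qsample_cellW_eq`),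
  the point-Gaussian state `ptQsample ℓ c ws x = Σ_y p̂t(y) |x[ws ↦ y]⟩` (unit norm), the isometry
  `l2Norm_sum_smul_basisState` (`‖Σ aᵢ |f i⟩‖₂ = ‖a‖₂` for injective `f`), and
  **`l2Norm_qsample_sub_ptQsample_le`**: `‖qsample − ptQsample‖₂ ≤ 2c(2·2^ℓ + 1)`.

In Regev's setting `c = 2π/D²` with `D ≥ 2^{3n}` and `2^ℓ = poly(n)·D`, so the bound is `2^{-Ω(n)}`.
Everything here is proved; definitions have bodies; no named fact is introduced.

## References

* O. Regev, *On lattices, learning with errors, random linear codes, and cryptography*, J. ACM 56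
  (2009), art. 34, Lemma 3.12 (proof, eq. (10): "This can be done using the same standard techniques
  used in sampling from the normal distribution") [Regev2009].
* L. Grover, T. Rudolph, *Creating superpositions that correspond to efficiently integrable probability
  distributions*, arXiv:quant-ph/0208112 (2002), eq. (1) [GroverRudolph2002].
* E. Bernstein, U. Vazirani, *Quantum complexity theory*, SIAM J. Comput. 26 (1997), Lemma 3.6
  [BennettBernsteinBrassardVazirani1997].
-/

noncomputable section

namespace Literature.Computability.QuantumComplexity

open Finset Complex Cryptography Literature.Computability.Complexity Literature.Computability.Complexity.GaussIntegral
  GroverRudolph QState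

namespace GaussianCells

/-! ### The unit-cell integral against the point weight -/

/-- **The point amplitude** `q(u) = e^{-cu²/2}` (so that `q(u)² = e^{-cu²}` is the Gaussian weight of
the point `u`). [cite: Regev2009, Lemma 3.12 (eq. (10))] -/
def ptAmp (c u : ℝ) : ℝ := Real.exp (-(c * u ^ 2) / 2)

/-- `q(u) > 0`. [folklore] -/
theorem ptAmp_pos (c u : ℝ) : 0 < ptAmp c u := Real.exp_pos _

/-- `q(u)² = e^{-cu²}`. [folklore] -/
theorem ptAmp_sq (c u : ℝ) : ptAmp c u ^ 2 = Real.exp (-(c * u ^ 2)) := by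
  rw [ptAmp, sq, ← Real.exp_add]; congr 1; ring

/-- `q(u) = √(e^{-cu²})`. [folklore] -/
theorem ptAmp_eq_sqrt (c u : ℝ) : ptAmp c u = Real.sqrt (Real.exp (-(c * u ^ 2))) := by
  rw [← ptAmp_sq, Real.sqrt_sq (ptAmp_pos c u).le]

/-- On the cell `[u, u+1]`: `u² − (2|u|+1) ≤ t² ≤ u² + (2|u|+1)`. [folklore] -/
theorem sq_mem_of_mem_cell {u t : ℝ} (ht0 : u ≤ t) (ht1 : t ≤ u + 1) :
    u ^ 2 - (2 * |u| + 1) ≤ t ^ 2 ∧ t ^ 2 ≤ u ^ 2 + (2 * |u| + 1) := by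
  have h1 : 0 ≤ t - u := by linarith
  have h2 : t - u ≤ 1 := by linarith
  have h3 : u ≤ |u| := le_abs_self u
  have h4 : -|u| ≤ u := neg_abs_le u
  have hsq : t ^ 2 = u ^ 2 + (t - u) * (2 * u + (t - u)) := by ring
  constructor
  · nlinarith [mul_nonneg h1 (sub_nonneg.2 h2), mul_nonneg h1 (abs_nonneg u), mul_le_mul_of_nonneg_left h4 h1,
      mul_nonneg (sub_nonneg.2 h2) (abs_nonneg u)]
  · nlinarith [mul_nonneg h1 (sub_nonneg.2 h2), mul_nonneg h1 (abs_nonneg u), mul_le_mul_of_nonneg_left h3 h1,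
      mul_nonneg (sub_nonneg.2 h2) (abs_nonneg u)]

/-- **Lower sandwich**: `e^{-cu²} e^{-c(2|u|+1)} ≤ ∫_u^{u+1} e^{-ct²} dt` (`c ≥ 0`). [folklore] -/
theorem le_cellIntegral {c : ℝ} (hc : 0 ≤ c) (u : ℝ) :
    Real.exp (-(c * u ^ 2)) * Real.exp (-(c * (2 * |u| + 1))) ≤ gaussF c (u + 1) - gaussF c u := by
  rw [gaussF_sub]
  have hmono := intervalIntegral.integral_mono_on (μ := MeasureTheory.volume) (a := u) (b := u + 1)
    (f := fun _ => Real.exp (-(c * u ^ 2)) * Real.exp (-(c * (2 * |u| + 1))))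
    (g := fun t => Real.exp (-(c * t ^ 2))) (by linarith) intervalIntegrable_const
    (intervalIntegrable_integrand c _ _) (fun t ht => by
      rw [← Real.exp_add]
      exact Real.exp_le_exp.2 (by nlinarith [(sq_mem_of_mem_cell ht.1 ht.2).2]))
  rwa [intervalIntegral.integral_const, add_sub_cancel_left, one_smul] at hmono

/-- **Upper sandwich**: `∫_u^{u+1} e^{-ct²} dt ≤ e^{-cu²} e^{c(2|u|+1)}` (`c ≥ 0`). [folklore] -/
theorem cellIntegral_le {c : ℝ} (hc : 0 ≤ c) (u : ℝ) :
    gaussF c (u + 1) - gaussF c u ≤ Real.exp (-(c * u ^ 2)) * Real.exp (c * (2 * |u| + 1)) := by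
  rw [gaussF_sub]
  have hmono := intervalIntegral.integral_mono_on (μ := MeasureTheory.volume) (a := u) (b := u + 1)
    (f := fun t => Real.exp (-(c * t ^ 2)))
    (g := fun _ => Real.exp (-(c * u ^ 2)) * Real.exp (c * (2 * |u| + 1))) (by linarith)
    (intervalIntegrable_integrand c _ _) intervalIntegrable_const (fun t ht => by
      rw [← Real.exp_add]
      exact Real.exp_le_exp.2 (by nlinarith [(sq_mem_of_mem_cell ht.1 ht.2).1]))
  rwa [intervalIntegral.integral_const, add_sub_cancel_left, one_smul] at hmono

/-- The cell integral is nonnegative. [folklore] -/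
theorem cellIntegral_nonneg (c u : ℝ) : 0 ≤ gaussF c (u + 1) - gaussF c u :=
  sub_nonneg.2 (gaussF_mono c (by linarith))

/-- **`|√(∫_u^{u+1} e^{-ct²}) − e^{-cu²/2}| ≤ c(2|u|+1) · e^{-cu²/2}`** whenever `c(2|u|+1) ≤ 2`
(`√(e^{±η}) = e^{±η/2} = 1 ± O(η)`). [cite: Regev2009, Lemma 3.12 (proof: "to within good precision")] -/
theorem abs_sqrt_cellIntegral_sub_ptAmp_le {c : ℝ} (hc : 0 ≤ c) (u : ℝ) (hη : c * (2 * |u| + 1) ≤ 2) :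
    |Real.sqrt (gaussF c (u + 1) - gaussF c u) - ptAmp c u| ≤ c * (2 * |u| + 1) * ptAmp c u := by
  set η : ℝ := c * (2 * |u| + 1) with hηdef
  set q : ℝ := ptAmp c u with hqdef
  set I : ℝ := gaussF c (u + 1) - gaussF c u with hI
  have hq : 0 < q := ptAmp_pos c u
  have hη0 : 0 ≤ η := by rw [hηdef]; have := abs_nonneg u; positivity
  have hq2 : q ^ 2 = Real.exp (-(c * u ^ 2)) := ptAmp_sq c u
  -- `q e^{-η/2} ≤ √I ≤ q e^{η/2}`
  have hup : Real.sqrt I ≤ q * Real.exp (η / 2) := by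
    have h := cellIntegral_le hc u
    rw [← hq2] at h
    calc Real.sqrt I ≤ Real.sqrt (q ^ 2 * Real.exp η) := Real.sqrt_le_sqrt h
      _ = q * Real.exp (η / 2) := by rw [Real.sqrt_mul (sq_nonneg q), Real.sqrt_sq hq.le, Real.exp_half]
  have hlo : q * Real.exp (-η / 2) ≤ Real.sqrt I := by
    have h := le_cellIntegral hc u
    rw [← hq2] at h
    calc q * Real.exp (-η / 2) = Real.sqrt (q ^ 2 * Real.exp (-η)) := by
          rw [Real.sqrt_mul (sq_nonneg q), Real.sqrt_sq hq.le, ← Real.exp_half, neg_div]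
      _ ≤ Real.sqrt I := Real.sqrt_le_sqrt h
  -- `e^{±η/2} = 1 ± O(η)`
  have h1 : Real.exp (η / 2) - 1 ≤ η := by
    have hx : |η / 2| ≤ 1 := by rw [abs_le]; constructor <;> linarith
    have h := Real.abs_exp_sub_one_le hx
    rw [abs_of_nonneg (by linarith : (0 : ℝ) ≤ η / 2)] at h
    linarith [le_abs_self (Real.exp (η / 2) - 1)]
  have h2 : 1 - Real.exp (-η / 2) ≤ η := by
    have hx : |(-η / 2)| ≤ 1 := by rw [abs_le]; constructor <;> linarith
    have h := Real.abs_exp_sub_one_le hx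
    have habs : |(-η / 2)| = η / 2 := by rw [abs_of_nonpos (by linarith)]; ring
    rw [habs] at h
    linarith [neg_abs_le (Real.exp (-η / 2) - 1)]
  rw [abs_le]
  constructor
  · have : q * (1 - Real.exp (-η / 2)) ≤ q * η := mul_le_mul_of_nonneg_left h2 hq.le
    nlinarith
  · have : q * (Real.exp (η / 2) - 1) ≤ q * η := mul_le_mul_of_nonneg_left h1 hq.le
    nlinarith

/-! ### The amplitude vectors on labels -/

variable (ℓ : ℕ) (c : ℝ)

/-- **The cell amplitude vector** `y ↦ √(w y)` (unnormalised Grover–Rudolph amplitudes).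
[cite: GroverRudolph2002, eq. (1)] -/
def cellAmpVec : (Fin ℓ → Bool) → ℂ := fun y => ((Real.sqrt (cellW ℓ c y) : ℝ) : ℂ)

/-- **The point amplitude vector** `y ↦ e^{-c u(y)²/2}`. [cite: Regev2009, Lemma 3.12 (eq. (10))] -/
def ptAmpVec : (Fin ℓ → Bool) → ℂ := fun y => ((ptAmp c (cellPt ℓ y) : ℝ) : ℂ)

/-- `|u(y)| ≤ 2^ℓ`. [folklore] -/
theorem abs_cellPt_le (y : Fin ℓ → Bool) : |(cellPt ℓ y : ℝ)| ≤ 2 ^ ℓ := by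
  have h1 : (binVal y : ℝ) < 2 ^ ℓ := by exact_mod_cast binVal_lt y
  have h2 : (2 : ℝ) ^ (ℓ - 1) ≤ 2 ^ ℓ := pow_le_pow_right₀ (by norm_num) (Nat.sub_le _ _)
  have h3 : (0 : ℝ) ≤ binVal y := Nat.cast_nonneg _
  have h4 : (0 : ℝ) ≤ 2 ^ (ℓ - 1) := by positivity
  unfold cellPt
  push_cast
  rw [abs_le]
  constructor <;> linarith

/-- The point amplitude vector is nonzero (labels exist). [folklore] -/
theorem ptAmpVec_ne_zero : ptAmpVec ℓ c ≠ 0 := fun h => by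
  have h0 := congrFun h (fun _ => false)
  simp only [ptAmpVec, Pi.zero_apply, Complex.ofReal_eq_zero] at h0
  exact (ptAmp_pos _ _).ne' h0

/-- **Termwise relative closeness gives `‖cell − pt‖₂ ≤ η ‖pt‖₂`**, `η = c(2·2^ℓ + 1) ≤ 2`.
[cite: Regev2009, Lemma 3.12 (proof)] -/
theorem l2_cellAmpVec_sub_ptAmpVec_le (hc : 0 ≤ c) (hη : c * (2 * 2 ^ ℓ + 1) ≤ 2) :
    l2 (cellAmpVec ℓ c - ptAmpVec ℓ c) ≤ c * (2 * 2 ^ ℓ + 1) * l2 (ptAmpVec ℓ c) := by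
  set η : ℝ := c * (2 * 2 ^ ℓ + 1) with hηdef
  have hη0 : 0 ≤ η := by positivity
  have hterm : ∀ y : Fin ℓ → Bool, ‖(cellAmpVec ℓ c - ptAmpVec ℓ c) y‖ ≤ η * ‖ptAmpVec ℓ c y‖ := by
    intro y
    have hu := abs_cellPt_le ℓ y
    have hηu : c * (2 * |(cellPt ℓ y : ℝ)| + 1) ≤ η := by rw [hηdef]; gcongr
    simp only [Pi.sub_apply, cellAmpVec, ptAmpVec, ← Complex.ofReal_sub, Complex.norm_real, Real.norm_eq_abs,
      abs_of_pos (ptAmp_pos _ _)]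
    have hcell : cellW ℓ c y = gaussF c ((cellPt ℓ y : ℝ) + 1) - gaussF c (cellPt ℓ y) := rfl
    rw [hcell]
    refine (abs_sqrt_cellIntegral_sub_ptAmp_le hc _ (hηu.trans hη)).trans ?_
    exact mul_le_mul_of_nonneg_right hηu (ptAmp_pos _ _).le
  have hsq : l2 (cellAmpVec ℓ c - ptAmpVec ℓ c) ^ 2 ≤ (η * l2 (ptAmpVec ℓ c)) ^ 2 := by
    rw [l2_sq, mul_pow, l2_sq, mul_sum]
    refine sum_le_sum fun y _ => ?_
    rw [← mul_pow]
    exact pow_le_pow_left₀ (norm_nonneg _) (hterm y) 2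
  exact (pow_le_pow_iff_left₀ (l2_nonneg _) (mul_nonneg hη0 (l2_nonneg _)) two_ne_zero).1 hsq

/-- **The normalised cell and point amplitude vectors are within `2c(2·2^ℓ + 1)`.**
[cite: Regev2009, Lemma 3.12 (proof)] [cite: BennettBernsteinBrassardVazirani1997, Lemma 3.6] -/
theorem l2_normalize_ptAmpVec_sub_normalize_cellAmpVec_le (hc : 0 ≤ c) (hη : c * (2 * 2 ^ ℓ + 1) ≤ 2) :
    l2 (normalize (ptAmpVec ℓ c) - normalize (cellAmpVec ℓ c)) ≤ 2 * (c * (2 * 2 ^ ℓ + 1)) := by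
  refine l2_normalize_sub_normalize_le (ptAmpVec_ne_zero ℓ c) ?_
  rw [l2_sub_comm]
  exact l2_cellAmpVec_sub_ptAmpVec_le ℓ c hc hη

/-! ### On a register: the qsample against the point-Gaussian state -/

variable {N : ℕ}

/-- **Superpositions of distinct basis states are isometric to their coefficient vectors**:
`normSq (Σᵢ aᵢ |f i⟩) = Σᵢ |aᵢ|²` for injective `f`. [cite: NielsenChuang2010, §2.1.4] -/
theorem normSq_sum_smul_basisState {ι : Type*} [Fintype ι] {f : ι → QReg N} (hf : Function.Injective f) (a : ι → ℂ) :
    Cryptography.normSq (∑ i, a i • basisState (f i)) = ∑ i, ‖a i‖ ^ 2 := by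
  classical
  unfold Cryptography.normSq
  have happ : ∀ z : QReg N, (∑ i, a i • basisState (f i)) z = if h : z ∈ Set.range f then a h.choose else 0 := by
    intro z
    rw [Finset.sum_apply]
    simp only [Pi.smul_apply, basisState_apply, smul_eq_mul, mul_ite, mul_one, mul_zero]
    split_ifs with h
    · have hspec := h.choose_spec
      rw [Finset.sum_eq_single h.choose]
      · rw [if_pos hspec.symm]
      · intro i _ hi
        rw [if_neg]
        intro e; apply hi
        exact hf (by rw [← e, hspec])
      · simp
    · exact Finset.sum_eq_zero fun i _ => if_neg fun e => h ⟨i, e.symm⟩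
  simp_rw [happ]
  rw [← Finset.sum_filter_add_sum_filter_not univ (fun z => z ∈ Set.range f)]
  have hzero : ∑ z ∈ univ.filter (fun z => z ∉ Set.range f), ‖(if h : z ∈ Set.range f then a h.choose else 0)‖ ^ 2 = 0 :=
    Finset.sum_eq_zero fun z hz => by rw [mem_filter] at hz; rw [dif_neg hz.2]; simp
  rw [hzero, add_zero]
  have himg : univ.filter (fun z => z ∈ Set.range f) = univ.image f := by
    ext z; simp [Set.mem_range, eq_comm]
  rw [himg, sum_image fun i _ i' _ h => hf h]
  refine sum_congr rfl fun i _ => ?_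
  have h : f i ∈ Set.range f := ⟨i, rfl⟩
  rw [dif_pos h, hf h.choose_spec]

/-- The same for the `ℓ²`-norm: `‖Σᵢ aᵢ |f i⟩‖₂ = ‖a‖₂`. [cite: NielsenChuang2010, §2.1.4] -/
theorem l2Norm_sum_smul_basisState {ι : Type*} [Fintype ι] {f : ι → QReg N} (hf : Function.Injective f) (a : ι → ℂ) :
    l2Norm (∑ i, a i • basisState (f i)) = l2 a := by
  rw [l2Norm_eq_sqrt_normSq, normSq_sum_smul_basisState hf, l2_eq_sqrt]

/-- `‖cell‖₂² = W` (the total weight). [folklore] -/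
theorem l2_cellAmpVec_sq : l2 (cellAmpVec ℓ c) ^ 2 = total (cellW ℓ c) := by
  rw [l2_sq, total]
  refine sum_congr rfl fun y _ => ?_
  rw [cellAmpVec, Complex.norm_real, Real.norm_eq_abs, sq_abs, Real.sq_sqrt (cellW_nonneg ℓ c y)]

/-- **The Grover–Rudolph qsample of the cell weights is `Σ_y ĉell(y) |x[ws ↦ y]⟩`.** [cite: GroverRudolph2002, eq. (1)] -/
theorem qsample_cellW_eq (ws : Fin ℓ ↪ Fin N) (x : QReg N) :
    qsample (cellW ℓ c) ws x = ∑ y, normalize (cellAmpVec ℓ c) y • basisState (writeY ws x y) := by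
  unfold qsample
  refine sum_congr rfl fun y _ => ?_
  congr 1
  have hW : l2 (cellAmpVec ℓ c) = Real.sqrt (total (cellW ℓ c)) := by
    rw [← l2_cellAmpVec_sq, Real.sqrt_sq (l2_nonneg _)]
  rw [QState.normalize, Pi.smul_apply, cellAmpVec, Complex.real_smul, hW,
    Real.sqrt_div (cellW_nonneg ℓ c y), div_eq_inv_mul, Complex.ofReal_mul]

/-- **The point-Gaussian state on the register**: `Σ_y p̂t(y) |x[ws ↦ y]⟩`, the normalised
`Σ_u e^{-cu²/2} |u⟩` of Regev's eq. (10) written on the wires `ws`. [cite: Regev2009, Lemma 3.12 (eq. (10))] -/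
def ptQsample (ws : Fin ℓ ↪ Fin N) (x : QReg N) : QReg N → ℂ :=
  ∑ y, normalize (ptAmpVec ℓ c) y • basisState (writeY ws x y)

/-- The point-Gaussian state is a unit vector. [folklore] -/
theorem l2Norm_ptQsample (ws : Fin ℓ ↪ Fin N) (x : QReg N) : l2Norm (ptQsample ℓ c ws x) = 1 := by
  rw [ptQsample, l2Norm_sum_smul_basisState (writeY_injective ws x), l2_normalize (ptAmpVec_ne_zero ℓ c)]

/-- **The cell qsample is within `2c(2·2^ℓ + 1)` of the point-Gaussian state** (in `ℓ²`-norm, for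
`c ≥ 0` with `c(2·2^ℓ + 1) ≤ 2`). [cite: Regev2009, Lemma 3.12 (proof)] [cite: GroverRudolph2002, eq. (1)] -/
theorem l2Norm_qsample_sub_ptQsample_le (hc : 0 ≤ c) (hη : c * (2 * 2 ^ ℓ + 1) ≤ 2) (ws : Fin ℓ ↪ Fin N) (x : QReg N) :
    l2Norm (qsample (cellW ℓ c) ws x - ptQsample ℓ c ws x) ≤ 2 * (c * (2 * 2 ^ ℓ + 1)) := by
  rw [qsample_cellW_eq, ptQsample, ← sum_sub_distrib]
  have h : ∑ y, (normalize (cellAmpVec ℓ c) y • basisState (writeY ws x y) - normalize (ptAmpVec ℓ c) y • basisState (writeY ws x y)) =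
      ∑ y, (normalize (cellAmpVec ℓ c) - normalize (ptAmpVec ℓ c)) y • basisState (writeY ws x y) :=
    sum_congr rfl fun y _ => by rw [Pi.sub_apply, sub_smul]
  rw [h, l2Norm_sum_smul_basisState (writeY_injective ws x), l2_sub_comm]
  exact l2_normalize_ptAmpVec_sub_normalize_cellAmpVec_le ℓ c hc hη

end GaussianCells

end Literature.Computability.QuantumComplexity

end
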